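import Summits.Parity.GeneralizedHardyLittlewood.Theorems.LiouvilleShiftedTablesEngineToPairsSieveDispatch

/-!
# Correlation sieve for line `Sketch` of the crux `EngineToPairs` (stmt-Parity-14659), part 3a:
# triple-sum expansion, the Type-I₂ shape reduction, locality and truncation of the functional

Support file for the stub `stub_sieve : CorrelationSieveFamily`, continuing part 2
(`…EngineToPairsSieveDispatch`).

* `sum_Icc_mul_apply_mul_weight` — `∑_{k ≤ N} (σ ⋆ τ)(k) W(k) = ∑_{s ≤ N} ∑_{t ≤ N, st ≤ N} σ(s) τ(t) W(st)`;
* `sum_Ioc_triple` — the functional at `α ⋆ σ ⋆ τ` as a triple sum over `x/2 < rst ≤ x`;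
* `filter_t_eq`, `sum_Ioc_typeI2_shape` — with `α` on `r ≤ R`, `σ` on `(S_a, S_b]` and `τ = 1_{(V,∞)}`,
  `2 R S_b V ≤ x`, the functional is an `r`-sum of flat/hyperbolic Type-I₂ sums (`t > V` is automatic);
* `sum_Ioc_mul_apply_congr_right` — locality: the functional at `α ⋆ β` only sees `β` on `[1, ⌊x⌋]`;
* `truncAt`, `sum_Ioc_mul_apply_truncate` — if `β` lives on `n ≥ N₀` then `α` may be truncated at `m N₀ ≤ x`.
-/

noncomputable section

namespace Summit.Parity.GeneralizedHardyLittlewood.Theorems.EngineToPairs.Sieve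

open Finset Real
open Literature.NumberTheory.Sieve

/-! ### Triple sums -/

/-- Weighted double-sum expansion on an initial segment:
`∑_{k ≤ N} (σ ⋆ τ)(k) W(k) = ∑_{s ≤ N} ∑_{t ≤ N, st ≤ N} σ(s) τ(t) W(st)`. [folklore] -/
theorem sum_Icc_mul_apply_mul_weight (σ τ : ArithmeticFunction ℝ) (W : ℕ → ℝ) (N : ℕ) :
    ∑ k ∈ Icc 1 N, (σ * τ) k * W k =
      ∑ s ∈ Icc 1 N, ∑ t ∈ (Icc 1 N).filter (fun t : ℕ => s * t ≤ N), σ s * τ t * W (s * t) := by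
  have hIoc : Ioc 0 N = Icc 1 N := rfl
  rw [← hIoc, BFI.sum_Ioc_mul_apply_mul, Finset.sum_filter, Finset.sum_product]
  refine Finset.sum_congr rfl fun s _ => ?_
  rw [Finset.sum_filter]

/-- **The functional at a triple product is a triple sum** (`x ≥ 0`):
`∑_{x/2<n≤x} (α ⋆ σ ⋆ τ)(n) w(n) = ∑_{r ≤ x} ∑_{s ≤ x} ∑_{t ≤ x, x/2 < rst ≤ x} α(r) σ(s) τ(t) w(rst)`.
[folklore] -/
theorem sum_Ioc_triple (α σ τ : ArithmeticFunction ℝ) (w : ℕ → ℝ) {x : ℝ} (hx : 0 ≤ x) :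
    ∑ n ∈ Ioc ⌊x / 2⌋₊ ⌊x⌋₊, (α * σ * τ) n * w n =
      ∑ r ∈ Icc 1 ⌊x⌋₊, ∑ s ∈ Icc 1 ⌊x⌋₊, ∑ t ∈ (Icc 1 ⌊x⌋₊).filter
        (fun t : ℕ => x / 2 < (r : ℝ) * s * t ∧ (r : ℝ) * s * t ≤ x),
          α r * σ s * τ t * w (r * s * t) := by
  classical
  set N := ⌊x⌋₊ with hN
  rw [mul_assoc, sum_Ioc_mul_apply_mul_weight α (σ * τ) w hx]
  refine Finset.sum_congr rfl fun r hr => ?_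
  have hr1 : 1 ≤ r := (Finset.mem_Icc.1 hr).1
  have hr1' : (1 : ℝ) ≤ r := by exact_mod_cast hr1
  -- inner sum over `k` with the product weight
  set W : ℕ → ℝ := fun k => if x / 2 < (r : ℝ) * k ∧ (r : ℝ) * k ≤ x then w (r * k) else 0 with hW
  have h1 : ∑ k ∈ (Icc 1 N).filter (fun k : ℕ => x / 2 < (r : ℝ) * k ∧ (r : ℝ) * k ≤ x),
      α r * (σ * τ) k * w (r * k) = α r * ∑ k ∈ Icc 1 N, (σ * τ) k * W k := by
    rw [Finset.mul_sum, Finset.sum_filter]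
    refine Finset.sum_congr rfl fun k _ => ?_
    by_cases h : x / 2 < (r : ℝ) * k ∧ (r : ℝ) * k ≤ x <;> simp [hW, h] ; ring
  rw [h1, sum_Icc_mul_apply_mul_weight, Finset.mul_sum]
  refine Finset.sum_congr rfl fun s hs => ?_
  have hs1 : (1 : ℝ) ≤ s := by exact_mod_cast (Finset.mem_Icc.1 hs).1
  rw [Finset.mul_sum, Finset.sum_filter, Finset.sum_filter]
  refine Finset.sum_congr rfl fun t _ => ?_
  have hcast : ((s * t : ℕ) : ℝ) = (s : ℝ) * t := by push_cast; ring
  by_cases hP : x / 2 < (r : ℝ) * s * t ∧ (r : ℝ) * s * t ≤ x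
  · have hst : s * t ≤ N := by
      rw [hN, natLe_floor_iff hx, hcast]
      have h2 : (s : ℝ) * t ≤ (r : ℝ) * ((s : ℝ) * t) :=
        le_mul_of_one_le_left (by positivity) hr1'
      linarith [hP.2]
    have hP' : x / 2 < (r : ℝ) * ((s * t : ℕ) : ℝ) ∧ (r : ℝ) * ((s * t : ℕ) : ℝ) ≤ x := by
      rw [hcast, ← mul_assoc]; exact hP
    rw [if_pos hst, if_pos hP, hW]
    simp only [hP', and_self, if_true]
    rw [show r * (s * t) = r * s * t by ring]; ring
  · by_cases hst : s * t ≤ N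
    · rw [if_pos hst, if_neg hP, hW]
      have hP' : ¬ (x / 2 < (r : ℝ) * ((s * t : ℕ) : ℝ) ∧ (r : ℝ) * ((s * t : ℕ) : ℝ) ≤ x) := by
        rw [hcast, ← mul_assoc]; exact hP
      simp only [hP', if_false]; ring
    · rw [if_neg hst, if_neg hP]

/-! ### The Type-I₂ shape -/

section Shape

variable {x : ℝ}

/-- The `t`-range of the triple sum in the Type-I₂ situation: for `1 ≤ r ≤ R`, `1 ≤ s ≤ S_b`,
`2 R S_b V ≤ x`, the conditions `t ≤ x`, `x/2 < rst ≤ x`, `V < t` reduce to `t ≤ x/(sr)`, `x/2 < rst`.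
[this line] -/
theorem filter_t_eq {x R V : ℝ} (hx : 0 ≤ x) {r s : ℕ} {Sb : ℕ} (hr1 : 1 ≤ r) (hrR : (r : ℝ) ≤ R)
    (hs1 : 1 ≤ s) (hsS : s ≤ Sb) (hvac : 2 * R * Sb * V ≤ x) (G : ℕ → ℝ) :
    ∑ t ∈ (Icc 1 ⌊x⌋₊).filter (fun t : ℕ => x / 2 < (r : ℝ) * s * t ∧ (r : ℝ) * s * t ≤ x),
        (if V < (t : ℝ) then G t else 0) =
      ∑ t ∈ (Icc 1 ⌊x / (s * r)⌋₊).filter (fun t : ℕ => x / 2 < (r : ℝ) * s * t), G t := by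
  have hr0 : (0 : ℝ) < r := by exact_mod_cast hr1
  have hs0 : (0 : ℝ) < s := by exact_mod_cast hs1
  have hrs0 : (0 : ℝ) < (s : ℝ) * r := by positivity
  apply Finset.sum_bij (fun t _ => t)
  · intro t ht
    rw [Finset.mem_filter, Finset.mem_Icc] at ht ⊢
    refine ⟨⟨ht.1.1, ?_⟩, ht.2.1⟩
    rw [natLe_floor_iff (by positivity), le_div_iff₀ hrs0]
    calc (t : ℝ) * (s * r) = (r : ℝ) * s * t := by ring
      _ ≤ x := ht.2.2
  · intro t₁ _ t₂ _ h; exact h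
  · intro t ht
    rw [Finset.mem_filter, Finset.mem_Icc] at ht
    refine ⟨t, ?_, rfl⟩
    rw [Finset.mem_filter, Finset.mem_Icc]
    have htx : (t : ℝ) * (s * r) ≤ x := by
      rw [← le_div_iff₀ hrs0]; exact (natLe_floor_iff (by positivity)).1 ht.1.2
    refine ⟨⟨ht.1.1, ?_⟩, ht.2, ?_⟩
    · rw [natLe_floor_iff hx]
      calc (t : ℝ) = t * 1 := (mul_one _).symm
        _ ≤ t * (s * r) := by
            apply mul_le_mul_of_nonneg_left _ (Nat.cast_nonneg t)
            have : (1 : ℝ) ≤ s := by exact_mod_cast hs1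
            have : (1 : ℝ) ≤ r := by exact_mod_cast hr1
            nlinarith
        _ ≤ x := htx
    · calc (r : ℝ) * s * t = t * (s * r) := by ring
        _ ≤ x := htx
  · intro t ht
    rw [Finset.mem_filter] at ht
    -- `V < t` is automatic: `t > x/(2rs) ≥ x/(2 R S_b) ≥ V`
    have hsS' : (s : ℝ) ≤ Sb := by exact_mod_cast hsS
    have hVt : V < (t : ℝ) := by
      by_contra hle
      push Not at hle
      have ht0 : (0 : ℝ) ≤ t := Nat.cast_nonneg t
      have h1 : (r : ℝ) * s * t ≤ R * Sb * V := by
        have := mul_le_mul (mul_le_mul hrR hsS' hs0.le (hr0.le.trans hrR)) hle ht0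
          (mul_nonneg (hr0.le.trans hrR) (Nat.cast_nonneg Sb))
        linarith
      linarith [ht.2.1]
    rw [if_pos hVt]

/-- Restricting an `r`-sum to the support bound `r ≤ R` (`R ≤ x`). [this line] -/
theorem sum_Icc_floor_eq_sum_Icc_floor_of_supp {x R : ℝ} (hR0 : 0 ≤ R) (hRx : R ≤ x)
    (α : ArithmeticFunction ℝ) (hαsupp : ∀ r, α r ≠ 0 → (r : ℝ) ≤ R) (G : ℕ → ℝ) :
    ∑ r ∈ Icc 1 ⌊x⌋₊, α r * G r = ∑ r ∈ Icc 1 ⌊R⌋₊, α r * G r := by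
  have hsub : Icc 1 ⌊R⌋₊ ⊆ Icc 1 ⌊x⌋₊ := Icc_subset_Icc_right (Nat.floor_mono hRx)
  rw [← Finset.sum_subset hsub]
  intro r hr hr'
  have : α r = 0 := by
    by_contra h
    exact hr' (Finset.mem_Icc.2 ⟨(Finset.mem_Icc.1 hr).1, (natLe_floor_iff hR0).2 (hαsupp r h)⟩)
  simp [this]

/-- Splitting `∑_{s ≤ S_b} = ∑_{s ≤ S_a} + ∑_{S_a < s ≤ S_b}`. [folklore] -/
theorem sum_Icc_one_eq_add_sum_Ioc {Sa Sb : ℕ} (h : Sa ≤ Sb) (G : ℕ → ℝ) :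
    ∑ s ∈ Icc 1 Sb, G s = ∑ s ∈ Icc 1 Sa, G s + ∑ s ∈ Ioc Sa Sb, G s := by
  have h1 : Icc 1 Sb = Ioc 0 Sb := rfl
  have h2 : Icc 1 Sa = Ioc 0 Sa := rfl
  rw [h1, h2, ← Finset.sum_Ioc_consecutive G (Nat.zero_le Sa) h]

/-- The functional at `α ⋆ σ ⋆ 1_{(V,∞)}` with `σ` supported on `(S_a, S_b]`, as an `r`-sum of
differences of flat Type-I₂ sums (the common reduction behind both Type-I₂ dispatch lemmas). [this line] -/
theorem sum_Ioc_typeI2_shape (hx : 1 ≤ x) (α σf τf : ArithmeticFunction ℝ) {R V : ℝ} (hR1 : 1 ≤ R)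
    (hRxle : R ≤ x) (hαsupp : ∀ r, α r ≠ 0 → (r : ℝ) ≤ R) {Sa Sb : ℕ} (hSbx : (Sb : ℝ) ≤ x)
    (c : ℕ → ℝ) (hσ : ∀ s, σf s = if Sa < s ∧ s ≤ Sb then c s else 0)
    (hτ : ∀ t, τf t = if V < (t : ℝ) then 1 else 0) (hvac : 2 * R * Sb * V ≤ x) (wq : ℕ → ℝ) :
    ∑ n ∈ Ioc ⌊x / 2⌋₊ ⌊x⌋₊, (α * σf * τf) n * wq n =
      ∑ r ∈ Icc 1 ⌊R⌋₊, α r * ∑ s ∈ Ioc Sa Sb, c s *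
        ∑ t ∈ (Icc 1 ⌊x / (s * r)⌋₊).filter (fun t : ℕ => x / 2 < (r : ℝ) * s * t), wq (r * s * t) := by
  classical
  have hx0 : 0 ≤ x := by linarith
  rw [sum_Ioc_triple α σf τf wq hx0]
  -- factor `α r` out of the inner sums, then restrict `r ≤ R`
  have hfac : ∀ r ∈ Icc 1 ⌊x⌋₊, ∑ s ∈ Icc 1 ⌊x⌋₊, ∑ t ∈ (Icc 1 ⌊x⌋₊).filter
      (fun t : ℕ => x / 2 < (r : ℝ) * s * t ∧ (r : ℝ) * s * t ≤ x), α r * σf s * τf t * wq (r * s * t) =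
      α r * ∑ s ∈ Icc 1 ⌊x⌋₊, ∑ t ∈ (Icc 1 ⌊x⌋₊).filter
      (fun t : ℕ => x / 2 < (r : ℝ) * s * t ∧ (r : ℝ) * s * t ≤ x), σf s * τf t * wq (r * s * t) := by
    intro r _
    rw [Finset.mul_sum]
    refine Finset.sum_congr rfl fun s _ => ?_
    rw [Finset.mul_sum]
    exact Finset.sum_congr rfl fun t _ => by ring
  rw [Finset.sum_congr rfl hfac, sum_Icc_floor_eq_sum_Icc_floor_of_supp (by linarith) hRxle α hαsupp]
  refine Finset.sum_congr rfl fun r hr => ?_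
  have hr1 : 1 ≤ r := (Finset.mem_Icc.1 hr).1
  have hrR : (r : ℝ) ≤ R := (natLe_floor_iff (by linarith)).1 (Finset.mem_Icc.1 hr).2
  congr 1
  -- restrict the `s`-sum to `(S_a, S_b]`
  have hSbN : Sb ≤ ⌊x⌋₊ := (natLe_floor_iff hx0).2 hSbx
  have hsub : Ioc Sa Sb ⊆ Icc 1 ⌊x⌋₊ := fun s hs =>
    Finset.mem_Icc.2 ⟨Nat.succ_le_of_lt (lt_of_le_of_lt (Nat.zero_le _) (Finset.mem_Ioc.1 hs).1),
      (Finset.mem_Ioc.1 hs).2.trans hSbN⟩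
  rw [← Finset.sum_subset hsub]
  · refine Finset.sum_congr rfl fun s hs => ?_
    have hs' : Sa < s ∧ s ≤ Sb := Finset.mem_Ioc.1 hs
    have hs1 : 1 ≤ s := Nat.succ_le_of_lt (lt_of_le_of_lt (Nat.zero_le _) hs'.1)
    rw [Finset.mul_sum]
    rw [← filter_t_eq hx0 hr1 hrR hs1 hs'.2 hvac (fun t => c s * wq (r * s * t))]
    refine Finset.sum_congr rfl fun t _ => ?_
    rw [hσ s, if_pos hs', hτ t]
    split_ifs <;> ring
  · intro s _ hs
    have hs' : ¬ (Sa < s ∧ s ≤ Sb) := fun h => hs (Finset.mem_Ioc.2 h)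
    refine Finset.sum_eq_zero fun t _ => ?_
    rw [hσ s, if_neg hs']; ring

end Shape

/-! ### Locality and truncation of the functional -/

/-- **Locality in the second factor**: the functional at `α ⋆ β` only sees `β` on `[1, ⌊x⌋]`. [folklore] -/
theorem sum_Ioc_mul_apply_congr_right (α β β' : ArithmeticFunction ℝ) (wq : ℕ → ℝ) {x : ℝ}
    (h : ∀ n : ℕ, 1 ≤ n → (n : ℝ) ≤ x → β n = β' n) :
    ∑ n ∈ Ioc ⌊x / 2⌋₊ ⌊x⌋₊, (α * β) n * wq n = ∑ n ∈ Ioc ⌊x / 2⌋₊ ⌊x⌋₊, (α * β') n * wq n := by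
  refine Finset.sum_congr rfl fun n hn => ?_
  congr 1
  rw [ArithmeticFunction.mul_apply, ArithmeticFunction.mul_apply]
  refine Finset.sum_congr rfl fun p hp => ?_
  obtain ⟨hpn, hn0⟩ := Nat.mem_divisorsAntidiagonal.1 hp
  have hp2 : 1 ≤ p.2 := Nat.pos_of_ne_zero fun h0 => hn0 (by rw [← hpn, h0, mul_zero])
  have hp2n : p.2 ≤ n := Nat.le_of_dvd (Nat.pos_of_ne_zero hn0) ⟨p.1, by rw [mul_comm]; exact hpn.symm⟩
  have hnx : (n : ℝ) ≤ x := by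
    rcases lt_or_ge x 0 with hx | hx
    · have : ⌊x⌋₊ = 0 := Nat.floor_of_nonpos hx.le
      have := (Finset.mem_Ioc.1 hn).2; omega
    · exact (natLe_floor_iff hx).1 (Finset.mem_Ioc.1 hn).2
  rw [h p.2 hp2 ((Nat.cast_le.2 hp2n).trans hnx)]

/-- The truncation of `α` at `m N₀ ≤ x`. [this line] -/
def truncAt (x : ℝ) (N₀ : ℕ) (α : ArithmeticFunction ℝ) : ArithmeticFunction ℝ where
  toFun m := if (m : ℝ) * N₀ ≤ x then α m else 0
  map_zero' := by simp

/-- Unfolding `truncAt`. [folklore] -/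
theorem truncAt_apply (x : ℝ) (N₀ : ℕ) (α : ArithmeticFunction ℝ) (m : ℕ) :
    truncAt x N₀ α m = if (m : ℝ) * N₀ ≤ x then α m else 0 := rfl

/-- `|truncAt x N₀ α| ≤ |α|` pointwise. [folklore] -/
theorem abs_truncAt_le (x : ℝ) (N₀ : ℕ) (α : ArithmeticFunction ℝ) (m : ℕ) : |truncAt x N₀ α m| ≤ |α m| := by
  rw [truncAt_apply]; split_ifs <;> simp

/-- Support of the truncation: `truncAt x N₀ α m ≠ 0 → m N₀ ≤ x`. [folklore] -/
theorem le_of_truncAt_ne_zero {x : ℝ} {N₀ : ℕ} {α : ArithmeticFunction ℝ} {m : ℕ} (h : truncAt x N₀ α m ≠ 0) :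
    (m : ℝ) * N₀ ≤ x := by
  rw [truncAt_apply] at h; by_contra h'; exact h (if_neg h')

/-- **Truncation**: if `β` lives on `n ≥ N₀` then in the functional at `α ⋆ β` only `m` with `m N₀ ≤ x`
matter: `α` may be replaced by `truncAt x N₀ α` (`x ≥ 0`). [this line] -/
theorem sum_Ioc_mul_apply_truncate (α β : ArithmeticFunction ℝ) (wq : ℕ → ℝ) {x : ℝ} (hx : 0 ≤ x) {N₀ : ℕ}
    (hβ : ∀ n, β n ≠ 0 → N₀ ≤ n) :
    ∑ n ∈ Ioc ⌊x / 2⌋₊ ⌊x⌋₊, (α * β) n * wq n = ∑ n ∈ Ioc ⌊x / 2⌋₊ ⌊x⌋₊, (truncAt x N₀ α * β) n * wq n := by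
  rw [sum_Ioc_mul_apply_mul_weight α β wq hx, sum_Ioc_mul_apply_mul_weight (truncAt x N₀ α) β wq hx]
  refine Finset.sum_congr rfl fun m _ => Finset.sum_congr rfl fun n hn => ?_
  rw [truncAt_apply]
  split_ifs with h
  · rfl
  · -- `m N₀ > x` but `m n ≤ x` with `β n ≠ 0 ⇒ n ≥ N₀`: so `β n = 0`
    by_cases hb : β n = 0
    · simp [hb]
    · exfalso
      have hN : (N₀ : ℝ) ≤ n := by exact_mod_cast hβ n hb
      have hmn := (Finset.mem_filter.1 hn).2.2
      exact h ((mul_le_mul_of_nonneg_left hN (Nat.cast_nonneg m)).trans hmn)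

end Summit.Parity.GeneralizedHardyLittlewood.Theorems.EngineToPairs.Sieve

namespace Summit.Parity.GeneralizedHardyLittlewood.Theorems.EngineToPairs

/-- Registered sub-goal of `stub_sieve` carried by this part (landing mechanics): splitting
`∑_{s ≤ S_b} = ∑_{s ≤ S_a} + ∑_{S_a < s ≤ S_b}` (used by the Type-I₂ shape). [folklore] -/
theorem sieve_part3a_anchor : ∀ (G : ℕ → ℝ) (Sa Sb : ℕ), Sa ≤ Sb →
    ∑ s ∈ Finset.Icc 1 Sb, G s = ∑ s ∈ Finset.Icc 1 Sa, G s + ∑ s ∈ Finset.Ioc Sa Sb, G s :=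
  fun G _ _ h => Sieve.sum_Icc_one_eq_add_sum_Ioc h G

end Summit.Parity.GeneralizedHardyLittlewood.Theorems.EngineToPairs

end
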